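import Summits.BirchSwinnertonDyer.BirchSwinnertonDyer.Theses.LeadingTerm
import Literature.NumberTheory.EllipticCurves.SelmerCorankControlProofs
import Literature.NumberTheory.EllipticCurves.SelmerCorankHolds
import Literature.NumberTheory.EllipticCurves.ZpCorankQuasiIso

/-!
# BirchSwinnertonDyer / LeadingTerm — crux `PinchPrime` (stmt-BirchSwinnertonDyer-16218),
# line `SketchIdeator2`, stub `stub_semisimpleOrder` (the order computation at a semisimple prime)

Registered stub of the lead skeleton `Cruxes/PinchPrime` (line `SketchIdeator2`). For an elliptic
curve `E/ℚ` (globally minimal `W`), a good ordinary prime `p ≥ 5`, the cyclotomic `ℤ_p`-extension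
datum `κ` with topological generator `γ`, and an Iwasawa datum `D : W.SelmerDualData κ γ` (the
Pontryagin dual `X = X(E/ℚ_∞)` of `Sel_{p^∞}(E/ℚ_∞)` as an abstract `Λ = ℤ_p⟦T⟧`-module) with `X`
finitely generated and torsion over `Λ`: **if multiplication by `T` on `V = ℚ_p ⊗_{ℤ_p} X` is
semisimple at `0` (`ker T² = ker T`, Greenberg LNM 1716 Conj. 1.12), `Ш(E/ℚ)[p^∞]` is finite and
`char_Λ X = (f_E)`, then `ord_{T=0} f_E = rank_ℤ E(ℚ)`** — granted, as a hypothesis, the control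
theorem in corank form `rank_{ℤ_p} X/TX = corank_{ℤ_p} Sel_{p^∞}(E/ℚ)` (tree named fact
`Greenberg1999_coinvariantsRank_eq_selmerCorank_rat`, Greenberg 1999 Thm. 1.2 / Mazur 1972 §6).

Proof (glue over proved tree theorems):

* Structure theorem under semisimplicity (PROVED,
  `Greenberg1999_order_charGenerator_eq_coinvariantsRank_holds`, Washington §13.2):
  `ord_T f_E = rank_{ℤ_p} X/TX` (`coinvariantsRank`).
* Control (hypothesis): `rank_{ℤ_p} X/TX = corank_{ℤ_p} Sel_{p^∞}(E/ℚ)` (`W.selmerCorank p`).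
* Kummer theory (PROVED, `WeierstrassCurve.selmerCorank_eq_mordellWeilRank_add_holds`,
  Greenberg 1999 §1): `corank Sel_{p^∞}(E/ℚ) = rank_ℤ E(ℚ) + corank Ш(E/ℚ)[p^∞]`.
* A finite group has `ℤ_p`-corank `0` (PROVED, `zpCorank_of_finite_eq_zero`).

Sources: R. Greenberg, *Iwasawa theory for elliptic curves*, LNM 1716 (1999), §1 (Thm. 1.2 and
p. 9 after Conj. 1.12); L. Washington, *Introduction to Cyclotomic Fields*, §13.2 (Thm. 13.12,
Prop. 13.8); B. Mazur, Invent. Math. 18 (1972), §6.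
-/

noncomputable section

set_option linter.dupNamespace false

namespace Summit.BirchSwinnertonDyer.BirchSwinnertonDyer.Cruxes.PinchPrime.FirstLayerStability

open scoped MatrixGroups ModularForm
open CongruenceSubgroup Literature.NumberTheory.EllipticCurves
  Literature.NumberTheory.EllipticCurves.ModularForms
open Summit.BirchSwinnertonDyer.BirchSwinnertonDyer.Theses

/-- **Order computation at a semisimple prime** (stub `stub_semisimpleOrder` of crux `PinchPrime`,
line `SketchIdeator2`). Granted the control theorem in corank form over `ℚ`
(`Greenberg1999_coinvariantsRank_eq_selmerCorank_rat`, a hypothesis): for `E/ℚ` elliptic with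
globally minimal model `W`, `p ≥ 5` good ordinary, `κ` the cyclotomic `ℤ_p`-extension with
topological generator `γ`, and a finitely generated torsion Iwasawa datum `D` such that
multiplication by `T` on `ℚ_p ⊗_{ℤ_p} X` satisfies `ker T² = ker T` (semisimplicity at `0`),
`Ш(E/ℚ)[p^∞]` is finite and `char_Λ X = (f_E)`, one has `ord_{T=0} f_E = rank_ℤ E(ℚ)`.
Chain: `ord_T f_E = rank_{ℤ_p} X/TX` (structure theorem under semisimplicity)
`= corank Sel_{p^∞}(E/ℚ)` (control) `= rank + corank Ш[p^∞]` (Kummer) `= rank`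
(`Ш[p^∞]` finite). [cite: Greenberg1999, §1 p. 9 (after Conj. 1.12)]; Greenberg (1999), Thm. 1.2;
Washington, §13.2. -/
theorem stub_semisimpleOrder :
    Greenberg1999_coinvariantsRank_eq_selmerCorank_rat →
    ∀ (W : WeierstrassCurve ℚ) [W.IsElliptic] [W.IsGloballyMinimal] (p : ℕ) [Fact p.Prime],
      5 ≤ p → IsOrdinaryAt W p →
      ∀ (κ : ZpExtension ℚ p) (γ : Field.absoluteGaloisGroup ℚ),
        κ.IsCyclotomic → κ.IsTopGenerator γ →
      ∀ (D : W.SelmerDualData κ γ) [Module.Finite (IwasawaAlgebra p) D.X], D.IsTorsion →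
        LinearMap.ker (IwasawaAlgebra.mulTRat p D.X ∘ₗ IwasawaAlgebra.mulTRat p D.X)
          = LinearMap.ker (IwasawaAlgebra.mulTRat p D.X) →
        Finite (AddCommGroup.primaryComponent W.sha p) →
      ∀ (fE : IwasawaAlgebra p), D.charIdeal = Ideal.span {fE} →
        fE.order = W.mordellWeilRank := by
  intro hcontrol W _ _ p _ _h5 hord κ γ hκ hγ D _ hX hss hfin fE hfE
  -- (d) Structure theorem under semisimplicity: `ord_T f_E = rank_{ℤ_p} X/TX`.
  have h1 : fE.order = (IwasawaAlgebra.coinvariantsRank p D.X : ℕ∞) :=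
    Greenberg1999_order_charGenerator_eq_coinvariantsRank_holds p D.X hX fE hfE hss
  -- (e) Control (hypothesis): `rank_{ℤ_p} X/TX = corank Sel_{p^∞}(E/ℚ)`.
  obtain ⟨-, h2⟩ := hcontrol W p hord.1 hord.2 κ γ hκ hγ D
  -- (f) Kummer theory: `corank Sel_{p^∞}(E/ℚ) = rank + corank Ш[p^∞]`.
  have h3 : W.selmerCorank p = W.mordellWeilRank + W.shaCorank p :=
    W.selmerCorank_eq_mordellWeilRank_add_holds p
  -- (g) `Ш[p^∞]` finite has corank `0`.
  have h4 : W.shaCorank p = 0 := by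
    haveI := hfin
    exact zpCorank_of_finite_eq_zero p
  rw [h1, h2, h3, h4, add_zero]

end Summit.BirchSwinnertonDyer.BirchSwinnertonDyer.Cruxes.PinchPrime.FirstLayerStability

end
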